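import Summits.BirchSwinnertonDyer.BirchSwinnertonDyer.Theorems.SylvesterTwoHeegnerIndexCoupledDescentFirstLayerOfLayerL1
import Summits.BirchSwinnertonDyer.BirchSwinnertonDyer.Theorems.SylvesterTwoHeegnerIndexCoupledDescentBottomClassInvariance
import HarnessLib

/-!
# L1Four′ / L1Seven′ (the first-layer leaf of VARIANT M) from ONE POINT per `(p, K)` carrying HSY's
# height display with exponent `0` NAMED and leaf (L1) for its own bottom class

Crux `UpperOffV0HSYPlus` (stmt-BirchSwinnertonDyer-19804); VARIANT K / M (D440–D441): the first-layer
stubs close by `firstLayerFour_of_layerL1` / `firstLayerSeven_of_layerL1` (p652267) from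
L1Four′ / L1Seven′ = «granted `PublishedFactsTwoPlus` and the first layer's own hypotheses
(`ord₂(#Ш_an(B)·#Ш_an(A)) = 0`), leaf (L1) holds for EVERY non-`2`-divisible bottom point `Y₀ ∈ E_p(K)`».

`layerL1Four_of_point` / `layerL1Seven_of_point`: L1Four′ (resp. L1Seven′) — its statement VERBATIM as
the conclusion — follows from ONE point `Y₁ ∈ E_p(K)` per member `p` and model `K ∋ ω` of `ℚ(ζ₃)` with
(a) **the height display NAMING `Y₁`**: for all minimal models `A ≅ E_{3p²}`, `B ≅ E_p` (`CB • B = E_p`)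
and `qB = #Ш_an(B)`, `qA = #Ш_an(A)` there are a `ℚ`-generator `P` of `B` and `Y ∈ B(K)` transporting
to `Y₁` with `(qB·qA)·ĥ(ιP) = 2⁰·ĥ(Y)` — the body of the route's fact
`HuShuYin2019.shaAnPair_mul_height_eq_two_zpow_mul_height` at `p ≡ 4 (9)` with ITS point named (the
fact only says `∃ Y`: «WEAKER THAN PRINT … `Y` is the explicit point `φ′(R − T)`», Hu–Shu–Yin Cor. 4.4
/ (bsd) p. 12); on `p ≡ 7 (9)` the SAME exponent-`0` display for the HALVED point `Y′`
(`Y = 2Y′ + T` by THEOREM C, crux 19802, and `ĥ(Y) = 4ĥ(Y′)` turns HSY's exponent `−2` into `0`);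
(b) **leaf (L1) for the bottom class `δY₁`, asked only if `Y₁` is not `2`-divisible** (THEOREM K2's
Kolyvagin input on its `m(p) = 0` slice: the coupled CM-frame classes, k-ty1 recipes, FLIP at `λ`).
Proof: `rank_ℤ B(K) = 2` from the route's display; Thm B′ `not_exists_two_smul_eq_of_padicValRat_eq`
at exponent `0` makes the NAMED point non-`2`-divisible under `ord₂(qB·qA) = 0`; (L1)[δY₁]; then
`hL1_of_hL1` (p647458) transports (L1) to every other non-divisible `Y₀`.  NET for the rows: L1Four′ =
{display-naming for the CM bottom point `P₁^{χ_B}` (a print statement once the point is a tree term),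
(L1) for `P₁^{χ_B}` under its non-divisibility}; `#17` and Thm B′ are inside.  Theorem-only; no stub
closed (the hypotheses are research); nothing asserted on 19804; no label moves; BSD not claimed.
-/

set_option linter.dupNamespace false -- Summits modules are `Summit.<Summit>.<Problem>…` by design

noncomputable section

open scoped Classical
open WeierstrassCurve WeierstrassCurve.Affine WeierstrassCurve.Affine.Point NumberField IsDedekindDomain
open Field Literature.NumberTheory.EllipticCurves Literature.NumberTheory.GaloisRepresentations
open Literature.NumberTheory.EllipticCurves.HuShuYin2019
open Summit.BirchSwinnertonDyer.BirchSwinnertonDyer.Theses.SylvesterTwoHeegnerIndex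
  hiding HSYPointTwoDivisibleSevenModNine

namespace Summit.BirchSwinnertonDyer.BirchSwinnertonDyer.Theorems.SylvesterTwoCoupledDescentCebotarev

open SylvesterTwoCoupledDescentPrimitivity

/-- **L1Four′ from ONE point with the named exponent-`0` display and (L1) for its bottom class**
(`p ≡ 4 (9)`; the rows take `Y₁ :=` the CM bottom point `P₁^{χ_B}` transported to `E_p(K)`).  The
conclusion is L1Four′ = `firstLayerFour_of_layerL1`'s hypothesis VERBATIM. -/
theorem layerL1Four_of_point
    (h : ∀ (p : ℕ), p.Prime → p % 9 = 4 → (¬ ∃ x : ZMod p, x ^ 3 = 3) →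
        ∀ (K : Type) [Field K] [NumberField K] (ω : K), ω ^ 2 + ω + 1 = 0 →
          Module.finrank ℚ K = 2 →
        ∃ Y₁ : ((cubeSumCurve (p : ℚ)).baseChange K).toAffine.Point,
          (∀ (A B : WeierstrassCurve ℚ) [A.IsElliptic] [A.IsGloballyMinimal] [B.IsElliptic]
              [B.IsGloballyMinimal] (CB : VariableChange ℚ)
              (hCB : CB • B = HuShuYin2019.cubeSumCurve (p : ℚ)),
            (∃ C : VariableChange ℚ, C • A = HuShuYin2019.cubeSumCurve (3 * (p : ℚ) ^ 2)) →
            ∀ (qB qA : ℚ), shaAn B = (qB : ℂ) → shaAn A = (qA : ℂ) →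
            ∃ (P : B.toAffine.Point) (Y : (B.baseChange K).toAffine.Point),
              ¬ IsOfFinAddOrder (WeierstrassCurve.QuadraticDescent.incl K B P) ∧
              (∀ Q : B.toAffine.Point, ∃ m : ℤ, IsOfFinAddOrder
                (WeierstrassCurve.QuadraticDescent.incl K B Q -
                  m • WeierstrassCurve.QuadraticDescent.incl K B P)) ∧
              ((qB * qA : ℚ) : ℝ) * canonicalHeight (WeierstrassCurve.QuadraticDescent.incl K B P) =
                (2 : ℝ) ^ (0 : ℤ) * canonicalHeight Y ∧
              Affine.Point.congrEquiv (congrArg (fun W : WeierstrassCurve ℚ ↦ W.baseChange K) hCB)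
                (VariableChange.pointEquivBaseChange B CB K Y) = Y₁) ∧
          ((¬ ∃ Q : ((cubeSumCurve (p : ℚ)).baseChange K).toAffine.Point, (2 : ℕ) • Q = Y₁) →
            ∃ (cA : ℕ → galH1Torsion ((cubeSumCurve (3 * (p : ℚ) ^ 2)).baseChange K) (2 : ℕ))
              (cB : ℕ → galH1Torsion ((cubeSumCurve (p : ℚ)).baseChange K) (2 : ℕ)),
            (∀ ℓ, (ℓ.Prime ∧ ¬ ℓ ∣ (cubeSumCurve (3 * (p : ℚ) ^ 2)).conductorNorm ℤ ∧
                ¬ ℓ ∣ (cubeSumCurve (p : ℚ)).conductorNorm ℤ ∧ ¬ ((ℓ : ℤ) ∣ NumberField.discr K) ∧ ℓ ≠ 2 ∧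
                (Ideal.span {(ℓ : 𝓞 K)}).IsPrime ∧
                FrobEqFrobInfty (cubeSumCurve (3 * (p : ℚ) ^ 2)) K 2 ℓ ∧
                FrobEqFrobInfty (cubeSumCurve (p : ℚ)) K 2 ℓ) →
              (∀ v : HeightOneSpectrum (𝓞 K), (ℓ : 𝓞 K) ∉ v.asIdeal →
                cA ℓ ∈ selmerLocalKer ((cubeSumCurve (3 * (p : ℚ) ^ 2)).baseChange K)
                  (v.adicCompletion K) (2 : ℕ)) ∧
              (∀ x : InfinitePlace K, cA ℓ ∈ selmerLocalKer
                ((cubeSumCurve (3 * (p : ℚ) ^ 2)).baseChange K) x.Completion (2 : ℕ)) ∧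
              (∀ v : HeightOneSpectrum (𝓞 K), (ℓ : 𝓞 K) ∈ v.asIdeal →
                (cA ℓ ∈ selmerLocalKer ((cubeSumCurve (3 * (p : ℚ) ^ 2)).baseChange K)
                    (v.adicCompletion K) (2 : ℕ) ↔
                  kummerClassOfPoint (cubeSumCurve (p : ℚ)) K Nat.prime_two Y₁ ∈
                    ((cubeSumCurve (p : ℚ)).baseChange K).torsionLocalKer (v.adicCompletion K) (2 : ℕ)))) ∧
            (∀ ℓ ℓ', (ℓ.Prime ∧ ¬ ℓ ∣ (cubeSumCurve (3 * (p : ℚ) ^ 2)).conductorNorm ℤ ∧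
                ¬ ℓ ∣ (cubeSumCurve (p : ℚ)).conductorNorm ℤ ∧ ¬ ((ℓ : ℤ) ∣ NumberField.discr K) ∧ ℓ ≠ 2 ∧
                (Ideal.span {(ℓ : 𝓞 K)}).IsPrime ∧
                FrobEqFrobInfty (cubeSumCurve (3 * (p : ℚ) ^ 2)) K 2 ℓ ∧
                FrobEqFrobInfty (cubeSumCurve (p : ℚ)) K 2 ℓ) →
              (ℓ'.Prime ∧ ¬ ℓ' ∣ (cubeSumCurve (3 * (p : ℚ) ^ 2)).conductorNorm ℤ ∧
                ¬ ℓ' ∣ (cubeSumCurve (p : ℚ)).conductorNorm ℤ ∧ ¬ ((ℓ' : ℤ) ∣ NumberField.discr K) ∧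
                ℓ' ≠ 2 ∧ (Ideal.span {(ℓ' : 𝓞 K)}).IsPrime ∧
                FrobEqFrobInfty (cubeSumCurve (3 * (p : ℚ) ^ 2)) K 2 ℓ' ∧
                FrobEqFrobInfty (cubeSumCurve (p : ℚ)) K 2 ℓ') → ℓ ≠ ℓ' →
              (∀ v : HeightOneSpectrum (𝓞 K), (ℓ : 𝓞 K) ∉ v.asIdeal → (ℓ' : 𝓞 K) ∉ v.asIdeal →
                cB (ℓ * ℓ') ∈ selmerLocalKer ((cubeSumCurve (p : ℚ)).baseChange K)
                  (v.adicCompletion K) (2 : ℕ)) ∧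
              (∀ x : InfinitePlace K,
                cB (ℓ * ℓ') ∈ selmerLocalKer ((cubeSumCurve (p : ℚ)).baseChange K) x.Completion (2 : ℕ)) ∧
              (∀ v : HeightOneSpectrum (𝓞 K), (ℓ : 𝓞 K) ∈ v.asIdeal →
                (cB (ℓ * ℓ') ∈ selmerLocalKer ((cubeSumCurve (p : ℚ)).baseChange K)
                    (v.adicCompletion K) (2 : ℕ) ↔
                  cA ℓ' ∈ ((cubeSumCurve (3 * (p : ℚ) ^ 2)).baseChange K).torsionLocalKer
                    (v.adicCompletion K) (2 : ℕ)))))) :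
    PublishedFactsTwoPlus →
    ∀ (p : ℕ), p.Prime → p % 9 = 4 → (¬ ∃ x : ZMod p, x ^ 3 = 3) →
      ∀ (A B : WeierstrassCurve ℚ) [A.IsElliptic] [A.IsGloballyMinimal] [B.IsElliptic]
        [B.IsGloballyMinimal], (∃ C : VariableChange ℚ, C • B = HuShuYin2019.cubeSumCurve (p : ℚ)) →
        (∃ C : VariableChange ℚ, C • A = HuShuYin2019.cubeSumCurve (3 * (p : ℚ) ^ 2)) →
        ∀ (qB qA : ℚ), shaAn B = (qB : ℂ) → shaAn A = (qA : ℂ) → qB * qA ≠ 0 →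
          padicValRat 2 (qB * qA) = 0 →
          ∀ (K : Type) [Field K] [NumberField K] (ω : K), ω ^ 2 + ω + 1 = 0 →
            Module.finrank ℚ K = 2 →
          ∀ Y₀ : ((cubeSumCurve (p : ℚ)).baseChange K).toAffine.Point,
            (¬ ∃ Q : ((cubeSumCurve (p : ℚ)).baseChange K).toAffine.Point, (2 : ℕ) • Q = Y₀) →
          ∃ (cA : ℕ → galH1Torsion ((cubeSumCurve (3 * (p : ℚ) ^ 2)).baseChange K) (2 : ℕ))
            (cB : ℕ → galH1Torsion ((cubeSumCurve (p : ℚ)).baseChange K) (2 : ℕ)),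
          (∀ ℓ, (ℓ.Prime ∧ ¬ ℓ ∣ (cubeSumCurve (3 * (p : ℚ) ^ 2)).conductorNorm ℤ ∧
              ¬ ℓ ∣ (cubeSumCurve (p : ℚ)).conductorNorm ℤ ∧ ¬ ((ℓ : ℤ) ∣ NumberField.discr K) ∧ ℓ ≠ 2 ∧
              (Ideal.span {(ℓ : 𝓞 K)}).IsPrime ∧
              FrobEqFrobInfty (cubeSumCurve (3 * (p : ℚ) ^ 2)) K 2 ℓ ∧
              FrobEqFrobInfty (cubeSumCurve (p : ℚ)) K 2 ℓ) →
            (∀ v : HeightOneSpectrum (𝓞 K), (ℓ : 𝓞 K) ∉ v.asIdeal →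
              cA ℓ ∈ selmerLocalKer ((cubeSumCurve (3 * (p : ℚ) ^ 2)).baseChange K)
                (v.adicCompletion K) (2 : ℕ)) ∧
            (∀ x : InfinitePlace K, cA ℓ ∈ selmerLocalKer
              ((cubeSumCurve (3 * (p : ℚ) ^ 2)).baseChange K) x.Completion (2 : ℕ)) ∧
            (∀ v : HeightOneSpectrum (𝓞 K), (ℓ : 𝓞 K) ∈ v.asIdeal →
              (cA ℓ ∈ selmerLocalKer ((cubeSumCurve (3 * (p : ℚ) ^ 2)).baseChange K)
                  (v.adicCompletion K) (2 : ℕ) ↔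
                kummerClassOfPoint (cubeSumCurve (p : ℚ)) K Nat.prime_two Y₀ ∈
                  ((cubeSumCurve (p : ℚ)).baseChange K).torsionLocalKer (v.adicCompletion K) (2 : ℕ)))) ∧
          (∀ ℓ ℓ', (ℓ.Prime ∧ ¬ ℓ ∣ (cubeSumCurve (3 * (p : ℚ) ^ 2)).conductorNorm ℤ ∧
              ¬ ℓ ∣ (cubeSumCurve (p : ℚ)).conductorNorm ℤ ∧ ¬ ((ℓ : ℤ) ∣ NumberField.discr K) ∧ ℓ ≠ 2 ∧
              (Ideal.span {(ℓ : 𝓞 K)}).IsPrime ∧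
              FrobEqFrobInfty (cubeSumCurve (3 * (p : ℚ) ^ 2)) K 2 ℓ ∧
              FrobEqFrobInfty (cubeSumCurve (p : ℚ)) K 2 ℓ) →
            (ℓ'.Prime ∧ ¬ ℓ' ∣ (cubeSumCurve (3 * (p : ℚ) ^ 2)).conductorNorm ℤ ∧
              ¬ ℓ' ∣ (cubeSumCurve (p : ℚ)).conductorNorm ℤ ∧ ¬ ((ℓ' : ℤ) ∣ NumberField.discr K) ∧
              ℓ' ≠ 2 ∧ (Ideal.span {(ℓ' : 𝓞 K)}).IsPrime ∧
              FrobEqFrobInfty (cubeSumCurve (3 * (p : ℚ) ^ 2)) K 2 ℓ' ∧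
              FrobEqFrobInfty (cubeSumCurve (p : ℚ)) K 2 ℓ') → ℓ ≠ ℓ' →
            (∀ v : HeightOneSpectrum (𝓞 K), (ℓ : 𝓞 K) ∉ v.asIdeal → (ℓ' : 𝓞 K) ∉ v.asIdeal →
              cB (ℓ * ℓ') ∈ selmerLocalKer ((cubeSumCurve (p : ℚ)).baseChange K)
                (v.adicCompletion K) (2 : ℕ)) ∧
            (∀ x : InfinitePlace K,
              cB (ℓ * ℓ') ∈ selmerLocalKer ((cubeSumCurve (p : ℚ)).baseChange K) x.Completion (2 : ℕ)) ∧
            (∀ v : HeightOneSpectrum (𝓞 K), (ℓ : 𝓞 K) ∈ v.asIdeal →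
              (cB (ℓ * ℓ') ∈ selmerLocalKer ((cubeSumCurve (p : ℚ)).baseChange K)
                  (v.adicCompletion K) (2 : ℕ) ↔
                cA ℓ' ∈ ((cubeSumCurve (3 * (p : ℚ) ^ 2)).baseChange K).torsionLocalKer
                  (v.adicCompletion K) (2 : ℕ)))) := by
  intro hF p hp h9 h3 A B _ _ _ _ hB hA qB qA hqB hqA hne hv K _ _ ω hω h2 Y₀ hY₀
  obtain ⟨Y₁, hdisp, hL1Y₁⟩ := h p hp h9 h3 K ω hω h2
  -- `rank_ℤ B(K) = 2` from the route's display (its only use here)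
  obtain ⟨-, -, -, -, -, hrank, -⟩ := hF.2 p hp (Or.inl h9) h3 A B hB hA K ω hω h2
  obtain ⟨CB, hCB⟩ := hB
  obtain ⟨P, Y, hP, hgen, hid, hYY₁⟩ := hdisp A B CB hCB hA qB qA hqB hqA
  have hp2 : p ≠ 2 := by rintro rfl; norm_num at h9
  -- the conjugation datum `θ₀ = 2ω + 1`, `θ₀² = -3`
  have hc : (2 * ω + 1) ^ 2 = algebraMap ℚ K (-3) := by
    rw [map_neg, map_ofNat]; linear_combination 4 * hω
  have hθ₀ : 2 * ω + 1 ∉ Set.range (algebraMap ℚ K) := by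
    rintro ⟨r, hr⟩
    have h1 : algebraMap ℚ K (r ^ 2) = algebraMap ℚ K (-3) := by rw [map_pow, hr, hc]
    have h3' : r ^ 2 = -3 := (algebraMap ℚ K).injective h1
    nlinarith [sq_nonneg r]
  -- Thm B′ at exponent `0`: the NAMED point `Y` is not `2`-divisible, hence neither is `Y₁`
  have hYnd : ¬ ∃ Q : (B.baseChange K).toAffine.Point, (2 : ℕ) • Q = Y :=
    not_exists_two_smul_eq_of_padicValRat_eq h2 hθ₀ hc hω hp hp2 B CB hCB hrank hP hgen Y
      (by exact_mod_cast hne) hid (by exact_mod_cast hv)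
  set ψ : (B.baseChange K).toAffine.Point ≃+ ((cubeSumCurve (p : ℚ)).baseChange K).toAffine.Point :=
    (VariableChange.pointEquivBaseChange B CB K).trans
      (Affine.Point.congrEquiv (congrArg (fun W : WeierstrassCurve ℚ ↦ W.baseChange K) hCB)) with hψ
  have hYψ : Y₁ = ψ Y := by rw [← hYY₁, hψ, AddEquiv.trans_apply]
  have hY₁nd : ¬ ∃ Q : ((cubeSumCurve (p : ℚ)).baseChange K).toAffine.Point, (2 : ℕ) • Q = Y₁ := by
    rintro ⟨Q, hQ⟩
    refine hYnd ⟨ψ.symm Q, ψ.injective ?_⟩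
    rw [map_nsmul, AddEquiv.apply_symm_apply, hQ, hYψ]
  -- (L1) for `δY₁`, transported to `δY₀` (bottom-class invariance, p647458)
  have hrank₀ : ((cubeSumCurve (p : ℚ)).baseChange K).mordellWeilRank = 2 :=
    mordellWeilRank_cubeSumCurve_of_variableChange B CB hCB hrank
  exact hL1_of_hL1 hω h2 hp hp2 hrank₀ (cubeSumCurve (3 * (p : ℚ) ^ 2))
    (fun ℓ ↦ ℓ.Prime ∧ ¬ ℓ ∣ (cubeSumCurve (3 * (p : ℚ) ^ 2)).conductorNorm ℤ ∧
      ¬ ℓ ∣ (cubeSumCurve (p : ℚ)).conductorNorm ℤ ∧ ¬ ((ℓ : ℤ) ∣ NumberField.discr K) ∧ ℓ ≠ 2 ∧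
      (Ideal.span {(ℓ : 𝓞 K)}).IsPrime ∧
      FrobEqFrobInfty (cubeSumCurve (3 * (p : ℚ) ^ 2)) K 2 ℓ ∧
      FrobEqFrobInfty (cubeSumCurve (p : ℚ)) K 2 ℓ)
    Y₁ Y₀ hY₁nd hY₀ (hL1Y₁ hY₁nd)

/-- **L1Seven′ from ONE point with the named exponent-`0` display and (L1) for its bottom class**
(`p ≡ 7 (9)`; the rows take `Y₁ :=` the HALVED CM bottom point `Y′` (`Y = 2Y′ + T`, THEOREM C) transported to `E_p(K)`).  The
conclusion is L1Seven′ = `firstLayerSeven_of_layerL1`'s hypothesis VERBATIM. -/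
theorem layerL1Seven_of_point
    (h : ∀ (p : ℕ), p.Prime → p % 9 = 7 → (¬ ∃ x : ZMod p, x ^ 3 = 3) →
        ∀ (K : Type) [Field K] [NumberField K] (ω : K), ω ^ 2 + ω + 1 = 0 →
          Module.finrank ℚ K = 2 →
        ∃ Y₁ : ((cubeSumCurve (p : ℚ)).baseChange K).toAffine.Point,
          (∀ (A B : WeierstrassCurve ℚ) [A.IsElliptic] [A.IsGloballyMinimal] [B.IsElliptic]
              [B.IsGloballyMinimal] (CB : VariableChange ℚ)
              (hCB : CB • B = HuShuYin2019.cubeSumCurve (p : ℚ)),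
            (∃ C : VariableChange ℚ, C • A = HuShuYin2019.cubeSumCurve (3 * (p : ℚ) ^ 2)) →
            ∀ (qB qA : ℚ), shaAn B = (qB : ℂ) → shaAn A = (qA : ℂ) →
            ∃ (P : B.toAffine.Point) (Y : (B.baseChange K).toAffine.Point),
              ¬ IsOfFinAddOrder (WeierstrassCurve.QuadraticDescent.incl K B P) ∧
              (∀ Q : B.toAffine.Point, ∃ m : ℤ, IsOfFinAddOrder
                (WeierstrassCurve.QuadraticDescent.incl K B Q -
                  m • WeierstrassCurve.QuadraticDescent.incl K B P)) ∧
              ((qB * qA : ℚ) : ℝ) * canonicalHeight (WeierstrassCurve.QuadraticDescent.incl K B P) =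
                (2 : ℝ) ^ (0 : ℤ) * canonicalHeight Y ∧
              Affine.Point.congrEquiv (congrArg (fun W : WeierstrassCurve ℚ ↦ W.baseChange K) hCB)
                (VariableChange.pointEquivBaseChange B CB K Y) = Y₁) ∧
          ((¬ ∃ Q : ((cubeSumCurve (p : ℚ)).baseChange K).toAffine.Point, (2 : ℕ) • Q = Y₁) →
            ∃ (cA : ℕ → galH1Torsion ((cubeSumCurve (3 * (p : ℚ) ^ 2)).baseChange K) (2 : ℕ))
              (cB : ℕ → galH1Torsion ((cubeSumCurve (p : ℚ)).baseChange K) (2 : ℕ)),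
            (∀ ℓ, (ℓ.Prime ∧ ¬ ℓ ∣ (cubeSumCurve (3 * (p : ℚ) ^ 2)).conductorNorm ℤ ∧
                ¬ ℓ ∣ (cubeSumCurve (p : ℚ)).conductorNorm ℤ ∧ ¬ ((ℓ : ℤ) ∣ NumberField.discr K) ∧ ℓ ≠ 2 ∧
                (Ideal.span {(ℓ : 𝓞 K)}).IsPrime ∧
                FrobEqFrobInfty (cubeSumCurve (3 * (p : ℚ) ^ 2)) K 2 ℓ ∧
                FrobEqFrobInfty (cubeSumCurve (p : ℚ)) K 2 ℓ) →
              (∀ v : HeightOneSpectrum (𝓞 K), (ℓ : 𝓞 K) ∉ v.asIdeal →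
                cA ℓ ∈ selmerLocalKer ((cubeSumCurve (3 * (p : ℚ) ^ 2)).baseChange K)
                  (v.adicCompletion K) (2 : ℕ)) ∧
              (∀ x : InfinitePlace K, cA ℓ ∈ selmerLocalKer
                ((cubeSumCurve (3 * (p : ℚ) ^ 2)).baseChange K) x.Completion (2 : ℕ)) ∧
              (∀ v : HeightOneSpectrum (𝓞 K), (ℓ : 𝓞 K) ∈ v.asIdeal →
                (cA ℓ ∈ selmerLocalKer ((cubeSumCurve (3 * (p : ℚ) ^ 2)).baseChange K)
                    (v.adicCompletion K) (2 : ℕ) ↔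
                  kummerClassOfPoint (cubeSumCurve (p : ℚ)) K Nat.prime_two Y₁ ∈
                    ((cubeSumCurve (p : ℚ)).baseChange K).torsionLocalKer (v.adicCompletion K) (2 : ℕ)))) ∧
            (∀ ℓ ℓ', (ℓ.Prime ∧ ¬ ℓ ∣ (cubeSumCurve (3 * (p : ℚ) ^ 2)).conductorNorm ℤ ∧
                ¬ ℓ ∣ (cubeSumCurve (p : ℚ)).conductorNorm ℤ ∧ ¬ ((ℓ : ℤ) ∣ NumberField.discr K) ∧ ℓ ≠ 2 ∧
                (Ideal.span {(ℓ : 𝓞 K)}).IsPrime ∧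
                FrobEqFrobInfty (cubeSumCurve (3 * (p : ℚ) ^ 2)) K 2 ℓ ∧
                FrobEqFrobInfty (cubeSumCurve (p : ℚ)) K 2 ℓ) →
              (ℓ'.Prime ∧ ¬ ℓ' ∣ (cubeSumCurve (3 * (p : ℚ) ^ 2)).conductorNorm ℤ ∧
                ¬ ℓ' ∣ (cubeSumCurve (p : ℚ)).conductorNorm ℤ ∧ ¬ ((ℓ' : ℤ) ∣ NumberField.discr K) ∧
                ℓ' ≠ 2 ∧ (Ideal.span {(ℓ' : 𝓞 K)}).IsPrime ∧
                FrobEqFrobInfty (cubeSumCurve (3 * (p : ℚ) ^ 2)) K 2 ℓ' ∧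
                FrobEqFrobInfty (cubeSumCurve (p : ℚ)) K 2 ℓ') → ℓ ≠ ℓ' →
              (∀ v : HeightOneSpectrum (𝓞 K), (ℓ : 𝓞 K) ∉ v.asIdeal → (ℓ' : 𝓞 K) ∉ v.asIdeal →
                cB (ℓ * ℓ') ∈ selmerLocalKer ((cubeSumCurve (p : ℚ)).baseChange K)
                  (v.adicCompletion K) (2 : ℕ)) ∧
              (∀ x : InfinitePlace K,
                cB (ℓ * ℓ') ∈ selmerLocalKer ((cubeSumCurve (p : ℚ)).baseChange K) x.Completion (2 : ℕ)) ∧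
              (∀ v : HeightOneSpectrum (𝓞 K), (ℓ : 𝓞 K) ∈ v.asIdeal →
                (cB (ℓ * ℓ') ∈ selmerLocalKer ((cubeSumCurve (p : ℚ)).baseChange K)
                    (v.adicCompletion K) (2 : ℕ) ↔
                  cA ℓ' ∈ ((cubeSumCurve (3 * (p : ℚ) ^ 2)).baseChange K).torsionLocalKer
                    (v.adicCompletion K) (2 : ℕ)))))) :
    PublishedFactsTwoPlus →
    ∀ (p : ℕ), p.Prime → p % 9 = 7 → (¬ ∃ x : ZMod p, x ^ 3 = 3) →
      ∀ (A B : WeierstrassCurve ℚ) [A.IsElliptic] [A.IsGloballyMinimal] [B.IsElliptic]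
        [B.IsGloballyMinimal], (∃ C : VariableChange ℚ, C • B = HuShuYin2019.cubeSumCurve (p : ℚ)) →
        (∃ C : VariableChange ℚ, C • A = HuShuYin2019.cubeSumCurve (3 * (p : ℚ) ^ 2)) →
        ∀ (qB qA : ℚ), shaAn B = (qB : ℂ) → shaAn A = (qA : ℂ) → qB * qA ≠ 0 →
          padicValRat 2 (qB * qA) = 0 →
          ∀ (K : Type) [Field K] [NumberField K] (ω : K), ω ^ 2 + ω + 1 = 0 →
            Module.finrank ℚ K = 2 →
          ∀ Y₀ : ((cubeSumCurve (p : ℚ)).baseChange K).toAffine.Point,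
            (¬ ∃ Q : ((cubeSumCurve (p : ℚ)).baseChange K).toAffine.Point, (2 : ℕ) • Q = Y₀) →
          ∃ (cA : ℕ → galH1Torsion ((cubeSumCurve (3 * (p : ℚ) ^ 2)).baseChange K) (2 : ℕ))
            (cB : ℕ → galH1Torsion ((cubeSumCurve (p : ℚ)).baseChange K) (2 : ℕ)),
          (∀ ℓ, (ℓ.Prime ∧ ¬ ℓ ∣ (cubeSumCurve (3 * (p : ℚ) ^ 2)).conductorNorm ℤ ∧
              ¬ ℓ ∣ (cubeSumCurve (p : ℚ)).conductorNorm ℤ ∧ ¬ ((ℓ : ℤ) ∣ NumberField.discr K) ∧ ℓ ≠ 2 ∧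
              (Ideal.span {(ℓ : 𝓞 K)}).IsPrime ∧
              FrobEqFrobInfty (cubeSumCurve (3 * (p : ℚ) ^ 2)) K 2 ℓ ∧
              FrobEqFrobInfty (cubeSumCurve (p : ℚ)) K 2 ℓ) →
            (∀ v : HeightOneSpectrum (𝓞 K), (ℓ : 𝓞 K) ∉ v.asIdeal →
              cA ℓ ∈ selmerLocalKer ((cubeSumCurve (3 * (p : ℚ) ^ 2)).baseChange K)
                (v.adicCompletion K) (2 : ℕ)) ∧
            (∀ x : InfinitePlace K, cA ℓ ∈ selmerLocalKer
              ((cubeSumCurve (3 * (p : ℚ) ^ 2)).baseChange K) x.Completion (2 : ℕ)) ∧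
            (∀ v : HeightOneSpectrum (𝓞 K), (ℓ : 𝓞 K) ∈ v.asIdeal →
              (cA ℓ ∈ selmerLocalKer ((cubeSumCurve (3 * (p : ℚ) ^ 2)).baseChange K)
                  (v.adicCompletion K) (2 : ℕ) ↔
                kummerClassOfPoint (cubeSumCurve (p : ℚ)) K Nat.prime_two Y₀ ∈
                  ((cubeSumCurve (p : ℚ)).baseChange K).torsionLocalKer (v.adicCompletion K) (2 : ℕ)))) ∧
          (∀ ℓ ℓ', (ℓ.Prime ∧ ¬ ℓ ∣ (cubeSumCurve (3 * (p : ℚ) ^ 2)).conductorNorm ℤ ∧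
              ¬ ℓ ∣ (cubeSumCurve (p : ℚ)).conductorNorm ℤ ∧ ¬ ((ℓ : ℤ) ∣ NumberField.discr K) ∧ ℓ ≠ 2 ∧
              (Ideal.span {(ℓ : 𝓞 K)}).IsPrime ∧
              FrobEqFrobInfty (cubeSumCurve (3 * (p : ℚ) ^ 2)) K 2 ℓ ∧
              FrobEqFrobInfty (cubeSumCurve (p : ℚ)) K 2 ℓ) →
            (ℓ'.Prime ∧ ¬ ℓ' ∣ (cubeSumCurve (3 * (p : ℚ) ^ 2)).conductorNorm ℤ ∧
              ¬ ℓ' ∣ (cubeSumCurve (p : ℚ)).conductorNorm ℤ ∧ ¬ ((ℓ' : ℤ) ∣ NumberField.discr K) ∧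
              ℓ' ≠ 2 ∧ (Ideal.span {(ℓ' : 𝓞 K)}).IsPrime ∧
              FrobEqFrobInfty (cubeSumCurve (3 * (p : ℚ) ^ 2)) K 2 ℓ' ∧
              FrobEqFrobInfty (cubeSumCurve (p : ℚ)) K 2 ℓ') → ℓ ≠ ℓ' →
            (∀ v : HeightOneSpectrum (𝓞 K), (ℓ : 𝓞 K) ∉ v.asIdeal → (ℓ' : 𝓞 K) ∉ v.asIdeal →
              cB (ℓ * ℓ') ∈ selmerLocalKer ((cubeSumCurve (p : ℚ)).baseChange K)
                (v.adicCompletion K) (2 : ℕ)) ∧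
            (∀ x : InfinitePlace K,
              cB (ℓ * ℓ') ∈ selmerLocalKer ((cubeSumCurve (p : ℚ)).baseChange K) x.Completion (2 : ℕ)) ∧
            (∀ v : HeightOneSpectrum (𝓞 K), (ℓ : 𝓞 K) ∈ v.asIdeal →
              (cB (ℓ * ℓ') ∈ selmerLocalKer ((cubeSumCurve (p : ℚ)).baseChange K)
                  (v.adicCompletion K) (2 : ℕ) ↔
                cA ℓ' ∈ ((cubeSumCurve (3 * (p : ℚ) ^ 2)).baseChange K).torsionLocalKer
                  (v.adicCompletion K) (2 : ℕ)))) := by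
  intro hF p hp h9 h3 A B _ _ _ _ hB hA qB qA hqB hqA hne hv K _ _ ω hω h2 Y₀ hY₀
  obtain ⟨Y₁, hdisp, hL1Y₁⟩ := h p hp h9 h3 K ω hω h2
  -- `rank_ℤ B(K) = 2` from the route's display (its only use here)
  obtain ⟨-, -, -, -, -, hrank, -⟩ := hF.2 p hp (Or.inr h9) h3 A B hB hA K ω hω h2
  obtain ⟨CB, hCB⟩ := hB
  obtain ⟨P, Y, hP, hgen, hid, hYY₁⟩ := hdisp A B CB hCB hA qB qA hqB hqA
  have hp2 : p ≠ 2 := by rintro rfl; norm_num at h9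
  -- the conjugation datum `θ₀ = 2ω + 1`, `θ₀² = -3`
  have hc : (2 * ω + 1) ^ 2 = algebraMap ℚ K (-3) := by
    rw [map_neg, map_ofNat]; linear_combination 4 * hω
  have hθ₀ : 2 * ω + 1 ∉ Set.range (algebraMap ℚ K) := by
    rintro ⟨r, hr⟩
    have h1 : algebraMap ℚ K (r ^ 2) = algebraMap ℚ K (-3) := by rw [map_pow, hr, hc]
    have h3' : r ^ 2 = -3 := (algebraMap ℚ K).injective h1
    nlinarith [sq_nonneg r]
  -- Thm B′ at exponent `0`: the NAMED point `Y` is not `2`-divisible, hence neither is `Y₁`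
  have hYnd : ¬ ∃ Q : (B.baseChange K).toAffine.Point, (2 : ℕ) • Q = Y :=
    not_exists_two_smul_eq_of_padicValRat_eq h2 hθ₀ hc hω hp hp2 B CB hCB hrank hP hgen Y
      (by exact_mod_cast hne) hid (by exact_mod_cast hv)
  set ψ : (B.baseChange K).toAffine.Point ≃+ ((cubeSumCurve (p : ℚ)).baseChange K).toAffine.Point :=
    (VariableChange.pointEquivBaseChange B CB K).trans
      (Affine.Point.congrEquiv (congrArg (fun W : WeierstrassCurve ℚ ↦ W.baseChange K) hCB)) with hψ
  have hYψ : Y₁ = ψ Y := by rw [← hYY₁, hψ, AddEquiv.trans_apply]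
  have hY₁nd : ¬ ∃ Q : ((cubeSumCurve (p : ℚ)).baseChange K).toAffine.Point, (2 : ℕ) • Q = Y₁ := by
    rintro ⟨Q, hQ⟩
    refine hYnd ⟨ψ.symm Q, ψ.injective ?_⟩
    rw [map_nsmul, AddEquiv.apply_symm_apply, hQ, hYψ]
  -- (L1) for `δY₁`, transported to `δY₀` (bottom-class invariance, p647458)
  have hrank₀ : ((cubeSumCurve (p : ℚ)).baseChange K).mordellWeilRank = 2 :=
    mordellWeilRank_cubeSumCurve_of_variableChange B CB hCB hrank
  exact hL1_of_hL1 hω h2 hp hp2 hrank₀ (cubeSumCurve (3 * (p : ℚ) ^ 2))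
    (fun ℓ ↦ ℓ.Prime ∧ ¬ ℓ ∣ (cubeSumCurve (3 * (p : ℚ) ^ 2)).conductorNorm ℤ ∧
      ¬ ℓ ∣ (cubeSumCurve (p : ℚ)).conductorNorm ℤ ∧ ¬ ((ℓ : ℤ) ∣ NumberField.discr K) ∧ ℓ ≠ 2 ∧
      (Ideal.span {(ℓ : 𝓞 K)}).IsPrime ∧
      FrobEqFrobInfty (cubeSumCurve (3 * (p : ℚ) ^ 2)) K 2 ℓ ∧
      FrobEqFrobInfty (cubeSumCurve (p : ℚ)) K 2 ℓ)
    Y₁ Y₀ hY₁nd hY₀ (hL1Y₁ hY₁nd)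

end Summit.BirchSwinnertonDyer.BirchSwinnertonDyer.Theorems.SylvesterTwoCoupledDescentCebotarev

end
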